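import Summits.QuantumFields.BalabanUV.Beta.CompositeAveragingCoarseExactLevels
import Summits.QuantumFields.BalabanUV.Beta.SymCorrectorForms

/-!
# `BalabanUV.Beta.CompositeAveragingCoarseExactGeneric` — binder row D1 ∕ (C1): **COARSE-EXACTNESS OF A COMPOSITE AVERAGING IS GENERIC IN THE ONE-STEP SCHEME** —
# an3-g37's K-U3b′ (`CompositeAveragingCoarseExactLevels`: `contourSum (L^m) − compLinAvgAt r L m = dz ∘ compDefectAt r L m` for the ROOTED comb average) re-proved for ANY family of
# one-step linear averagings `Av k` whose one-step defect against the straight contour sum is coarse-exact with a named potential `lam k` (§1), with the ROOTED scheme recovered as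
# an instance by `rfl`∕induction (§2) and the (0.4)-SYMMETRISED scheme — the composite of an2's `(d!)⁻¹ • symLinAvgAt` with potential `SymCorrectorForms.zetaS` — as the NEW
# instance (§3): `compLinAvgSymAt`, `compDefectSymAt`, **`contourSum_pow_sub_compLinAvgSymAt`** (row OWNER an2 gen 89; the form-level first brick of K-U3d-sym = option L's
# corrector, REFEREE-TABLE-89 v1.3 §2 ∕ road XREAD-L v1.3's seven displayed letter families)

WHAT ([folklore] finite-difference algebra over the cell's OWN typed objects; four bookkeeping `def`s [our object]; nothing cited, no `Prop` fact):
* §1 GENERIC.  Data: block side `L`, a one-step averaging per level `Av : ℕ → Form1 d ℝ → Form1 d ℝ`, its defect potential `lam : ℕ → Form1 d ℝ → Form0 d ℝ`; hypothesis (one line)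
  `hdef : ∀ k B μ Y, contourSum L B μ Y − Av k B μ Y = dz (lam k B) μ Y`.  Objects `compAvOf Av L m` (level `m+1` := `Av m ∘ level m`), `compDefectOf Av lam L m` (`ζ₀ = 0`,
  `ζ_{m+1} = blockSum L ζ_m + lam m (compAvOf … m A)`); TRANSPORT `contourSum_sub_Av_of_sub_eq_dz` («coarse-exact in ⟹ coarser-exact out», `contourSum_dz`); MAIN
  **`contourSum_pow_sub_compAvOf`**: `contourSum (L^m) A − compAvOf Av L m A = dz (compDefectOf Av lam L m A)` (induction; `contourSum_one`, `contourSum_mul`); funext form; `curv = 0`.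
* §2 ROOTED INSTANCE (= an3's objects): `Av k := linAvgAt (toSite (r k)) · L`, `lam k B := blockSum L (treeGaugeAt (toSite (r k)) B L)`, `hdef := AveragingPointsOfView.contourSum_sub_linAvgAt`;
  **`compAvOf_rooted_eq_compLinAvgAt`**, **`compDefectOf_rooted_eq_compDefectAt`** (induction; `blockSum` additivity) — so §1 at the rooted data IS K-U3b′ (nothing new there).
* §3 SYM INSTANCE [our objects]: `avSym ρs L k B := (d!)⁻¹ • symLinAvgAt (ρs k) B L` (the (0.4)-symmetrised one-step linear average, an2 `SymmetrisedAxialPotential`), `lamSym ρs L k := zetaS (ρs k) L`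
  (an2 `SymCorrectorForms`), `hdef` := `contourSum_sub_dz_zetaS` rearranged (`contourSum_sub_avSym`); **`compLinAvgSymAt ρs L m`**, **`compDefectSymAt ρs L m`** (the generic objects at
  the sym data, `rfl`), `_zero ∕ _succ ∕ _one`, and **`contourSum_pow_sub_compLinAvgSymAt (hL : 0 < L) : ∀ m μ Y, contourSum (L^m) A μ Y − compLinAvgSymAt ρs L m A μ Y = dz (compDefectSymAt
  ρs L m A) μ Y`** + funext form + `curv = 0` — the coarse-exact defect of the m-fold COMPOSITE (0.4) average with its EXPLICIT potential, i.e. the input the corrector pair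
  `Φˢ_m A := A − |box (L^m)|⁻¹ • dz (ext (L^m) (ζˢ_m A))`, `Ψˢ_m := …+…` needs (the pattern of `CompositeCorrectorForms` §5 ∕ `SymCorrectorForms` §3; NOT typed here).
WHY: REFEREE-TABLE-89 v1.3 §2's only charter-admissible non-HOLD port L replaces the record composite's ROOTED corrector `psiK` (built on `compDefectAt`) by a (0.4) corrector; road
XREAD-L v1.3 displays its seven letter families; K-U3d proved them for `psiK` from exactly three form-level inputs — coarse-exactness of the composite defect (K-U3b′), nilpotency on
block-constant gauges, mutual inversion.  This file supplies the FIRST for the sym scheme (and shows it is scheme-generic); nilpotency∕inversion and the kernelisation are the sequels.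
HONEST: lattice algebra BY NAME; nothing of Bałaban's asserted, valued or discharged; L is NOT commissioned (the referee's∕planner's decision) — this is charter-neutral library algebra usable by
either port; no END row discharged; the literal of record, ROOT M‴ ∕ P5c ∕ D6, v10 + END v3 + W untouched; 0∕4 row-D1 binders; NOT (C1), NOT (T-ID), NOT D1, NEVER «G-an2-4 closed», NOT
BetaPertH, NOT continuum, NOT Clay.  HONEST DEPENDENCY (page 1, mandatory): continuum YM on T⁴ ⇐ BetaPertH ∧ nine spine estimates (0/9 proved); BetaPertH ⇐ (D1) ∧ (D4) ∧ CAP+tail;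
G-an2-4 gates asym, D1 and NE2/3/4.  Row D1 ∕ (C1) OWNER an2, gen 89, 2026-08-30; over an3-g37 (`CompositeAveragingCoarseExactLevels`) and an2 (`SymCorrectorForms`,
`SymmetrisedAxialPotential`) BY NAME; no existing file touched.
-/

namespace Summit.QuantumFields.BalabanUV.Beta.CompositeAveragingCoarseExactGeneric

open Finset
open scoped BigOperators Nat
open Literature.MathematicalPhysics.QuantumFieldTheory.Balaban1983to89.Beta
open AffineAveraging (Site Form0 Form1 box toSite unitVec dz curv blockSum contourSum contourSum_dz curv_dz)
open AveragingContoursRooted (linAvgAt treeGaugeAt)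
open ResolventComposition (contourSum_mul contourSum_one)
open Summit.QuantumFields.BalabanUV.Beta.AveragingPointsOfView (contourSum_sub_linAvgAt)
open Summit.QuantumFields.BalabanUV.Beta.CompositeAveragingCoarseExact (compLinAvgAt compDefectAt compLinAvgAt_succ compDefectAt_succ contourSum_add_dz_apply)
open Summit.QuantumFields.BalabanUV.Beta.SymmetrisedAxialPotential (symLinAvgAt)
open Summit.QuantumFields.BalabanUV.Beta.SymCorrectorForms (zetaS contourSum_sub_dz_zetaS)

noncomputable section

variable {d : ℕ}

/-! ## §1 Generic: any one-step averaging with a coarse-exact one-step defect -/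

section Generic

variable (Av : ℕ → Form1 d ℝ → Form1 d ℝ) (lam : ℕ → Form1 d ℝ → Form0 d ℝ) (L : ℕ)

/-- [our object — bookkeeping] **THE m-FOLD COMPOSITE OF THE ONE-STEP AVERAGINGS `Av k`** (common block side `L`; level `k+1` := `Av k` applied to level `k`, read on `ℤ^d` again; `m = 0` the identity). -/
def compAvOf : ℕ → Form1 d ℝ → Form1 d ℝ
  | 0, A => A
  | m + 1, A => Av m (compAvOf m A)

/-- [our object — bookkeeping] **THE COARSE POTENTIAL OF THE COMPOSITE's DEFECT**: `ζ₀ = 0`, `ζ_{m+1} = blockSum L ζ_m + lam m (compAvOf … m A)`. -/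
def compDefectOf : ℕ → Form1 d ℝ → Form0 d ℝ
  | 0, _ => 0
  | m + 1, A => blockSum L (compDefectOf m A) + lam m (compAvOf Av m A)

/-- [folklore] `m = 0`: the identity. -/
@[simp] theorem compAvOf_zero (A : Form1 d ℝ) : compAvOf Av 0 A = A := rfl

/-- [folklore] The successor clause of `compAvOf`. -/
theorem compAvOf_succ (m : ℕ) (A : Form1 d ℝ) : compAvOf Av (m + 1) A = Av m (compAvOf Av m A) := rfl

/-- [folklore] `m = 0`: zero potential. -/
@[simp] theorem compDefectOf_zero (A : Form1 d ℝ) : compDefectOf Av lam L 0 A = 0 := rfl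

/-- [folklore] The successor clause of `compDefectOf`. -/
theorem compDefectOf_succ (m : ℕ) (A : Form1 d ℝ) :
    compDefectOf Av lam L (m + 1) A = blockSum L (compDefectOf Av lam L m A) + lam m (compAvOf Av m A) := rfl

/-- [folklore] `dz` is additive (pointwise). -/
theorem dz_add_apply (f g : Form0 d ℝ) (μ : Fin d) (Y : Site d) : dz (f + g) μ Y = dz f μ Y + dz g μ Y := by
  simp only [dz, Pi.add_apply]
  ring

/-- [folklore] **TRANSPORT («coarse-exact in ⟹ coarser-exact out»), GENERIC.**  If `C − B = dz g` and the one-step defect of `Av k` at `B` is `dz (lam k B)`, then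
`contourSum L C − Av k B = dz (blockSum L g + lam k B)` (`contourSum_dz`). -/
theorem contourSum_sub_Av_of_sub_eq_dz (k : ℕ) (B C : Form1 d ℝ) (g : Form0 d ℝ)
    (hdefB : ∀ μ Y, contourSum L B μ Y - Av k B μ Y = dz (lam k B) μ Y) (h : ∀ μ y, C μ y - B μ y = dz g μ y) (μ : Fin d) (Y : Site d) :
    contourSum L C μ Y - Av k B μ Y = dz (blockSum L g + lam k B) μ Y := by
  have hC : C = B + dz g := by
    funext μ' y'
    have := h μ' y'
    simp only [Pi.add_apply]
    linarith
  have h1 := hdefB μ Y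
  rw [hC, contourSum_add_dz_apply, dz_add_apply]
  linarith

/-- [folklore] **COARSE-EXACTNESS OF THE COMPOSITE's DEFECT, GENERIC IN THE SCHEME.**  For `0 < L` and any one-step family whose one-step defect is coarse-exact with potential
`lam k` at EVERY field: `contourSum (L^m) A − compAvOf Av m A = dz (compDefectOf Av lam L m A)` for every `m` (induction: `contourSum_one`; `contourSum_mul` + transport). -/
theorem contourSum_pow_sub_compAvOf (hL : 0 < L) (hdef : ∀ (k : ℕ) (B : Form1 d ℝ) (μ : Fin d) (Y : Site d), contourSum L B μ Y - Av k B μ Y = dz (lam k B) μ Y)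
    (A : Form1 d ℝ) : ∀ (m : ℕ) (μ : Fin d) (Y : Site d), contourSum (L ^ m) A μ Y - compAvOf Av m A μ Y = dz (compDefectOf Av lam L m A) μ Y
  | 0, μ, Y => by
      simp [compAvOf, compDefectOf, contourSum_one, dz]
  | m + 1, μ, Y => by
      rw [pow_succ, contourSum_mul (L ^ m) L (pow_pos hL m) A, compAvOf_succ, compDefectOf_succ]
      exact contourSum_sub_Av_of_sub_eq_dz Av lam L m (compAvOf Av m A) (contourSum (L ^ m) A) (compDefectOf Av lam L m A) (hdef m _)
        (fun μ' y' => contourSum_pow_sub_compAvOf hL hdef A m μ' y') μ Y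

/-- [folklore] The same as an identity of 1-forms. -/
theorem contourSum_pow_eq_compAvOf_add_dz (hL : 0 < L) (hdef : ∀ (k : ℕ) (B : Form1 d ℝ) (μ : Fin d) (Y : Site d), contourSum L B μ Y - Av k B μ Y = dz (lam k B) μ Y)
    (A : Form1 d ℝ) (m : ℕ) : contourSum (L ^ m) A = compAvOf Av m A + dz (compDefectOf Av lam L m A) := by
  funext μ Y
  have := contourSum_pow_sub_compAvOf Av lam L hL hdef A m μ Y
  simp only [Pi.add_apply]
  linarith

/-- [folklore] The composite defect is curvature-free on the coarse lattice (`curv_dz`). -/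
theorem curv_contourSum_pow_sub_compAvOf (hL : 0 < L) (hdef : ∀ (k : ℕ) (B : Form1 d ℝ) (μ : Fin d) (Y : Site d), contourSum L B μ Y - Av k B μ Y = dz (lam k B) μ Y)
    (A : Form1 d ℝ) (m : ℕ) : curv (contourSum (L ^ m) A - compAvOf Av m A) = 0 := by
  have h : contourSum (L ^ m) A - compAvOf Av m A = dz (compDefectOf Av lam L m A) := by
    rw [contourSum_pow_eq_compAvOf_add_dz Av lam L hL hdef A m]
    abel
  rw [h, curv_dz]

end Generic

/-! ## §2 The ROOTED instance IS an3's K-U3b′ objects -/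

section Rooted

variable (r : ℕ → (Fin d → ℕ)) (L : ℕ)

/-- [folklore] **THE ROOTED COMPOSITE IS `compLinAvgAt`**: the generic composite at `Av k := linAvgAt (toSite (r k)) · L` is an3's `compLinAvgAt r L` (induction; `rfl` steps). -/
theorem compAvOf_rooted_eq_compLinAvgAt :
    ∀ (m : ℕ) (A : Form1 d ℝ), compAvOf (fun k B => linAvgAt (toSite (r k)) B L) m A = compLinAvgAt r L m A
  | 0, _ => rfl
  | m + 1, A => by rw [compAvOf_succ, compLinAvgAt_succ, compAvOf_rooted_eq_compLinAvgAt m A]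

/-- [folklore] **THE ROOTED POTENTIAL IS `compDefectAt`**: at `lam k B := blockSum L (treeGaugeAt (toSite (r k)) B L)` the generic potential is an3's `compDefectAt r L`
(induction; `blockSum` additivity). -/
theorem compDefectOf_rooted_eq_compDefectAt :
    ∀ (m : ℕ) (A : Form1 d ℝ),
      compDefectOf (fun k B => linAvgAt (toSite (r k)) B L) (fun k B => blockSum L (treeGaugeAt (toSite (r k)) B L)) L m A = compDefectAt r L m A
  | 0, _ => rfl
  | m + 1, A => by
      rw [compDefectOf_succ, compDefectAt_succ, compDefectOf_rooted_eq_compDefectAt m A, compAvOf_rooted_eq_compLinAvgAt r L m A]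
      funext Y
      simp only [blockSum, Pi.add_apply, Finset.sum_add_distrib]

/-- [folklore] The rooted one-step defect hypothesis `hdef` is an3's `contourSum_sub_linAvgAt` — so §1 at the rooted data re-proves K-U3b′
(`CompositeAveragingCoarseExact.contourSum_pow_sub_compLinAvgAt`) with nothing new. -/
theorem contourSum_pow_sub_compLinAvgAt' (hL : 0 < L) (A : Form1 d ℝ) (m : ℕ) (μ : Fin d) (Y : Site d) :
    contourSum (L ^ m) A μ Y - compLinAvgAt r L m A μ Y = dz (compDefectAt r L m A) μ Y := by
  rw [← compAvOf_rooted_eq_compLinAvgAt r L m A, ← compDefectOf_rooted_eq_compDefectAt r L m A]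
  exact contourSum_pow_sub_compAvOf _ _ L hL (fun k B μ' Y' => contourSum_sub_linAvgAt (N := L) (r k) B μ' Y') A m μ Y

end Rooted

/-! ## §3 The (0.4)-SYMMETRISED instance: the composite (0.4) linear average and its coarse potential -/

section Sym

variable (ρs : ℕ → Site d) (L : ℕ)

/-- [our object — bookkeeping] **THE (0.4)-SYMMETRISED ONE-STEP LINEAR AVERAGE AS A MEAN** at level `k` (root `ρs k`, block `L`): `B ↦ (d!)⁻¹ • symLinAvgAt (ρs k) B L`
(an2's `symLinAvgAt` is the S_d-SUM of the comb averages; the mean is RULING R-D1-g25-2 (4)'s normalisation). -/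
def avSym (k : ℕ) (B : Form1 d ℝ) : Form1 d ℝ := fun μ y => ((d ! : ℕ) : ℝ)⁻¹ * symLinAvgAt (ρs k) B L μ y

/-- [our object — bookkeeping] its one-step defect potential: an2's `zetaS (ρs k) L` (`SymCorrectorForms`). -/
def lamSym (k : ℕ) (B : Form1 d ℝ) : Form0 d ℝ := zetaS (ρs k) L B

/-- [folklore] `avSym` unfolded (`rfl`). -/
theorem avSym_apply (k : ℕ) (B : Form1 d ℝ) (μ : Fin d) (y : Site d) : avSym ρs L k B μ y = ((d ! : ℕ) : ℝ)⁻¹ * symLinAvgAt (ρs k) B L μ y := rfl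

/-- [folklore] `lamSym` unfolded (`rfl`). -/
theorem lamSym_apply (k : ℕ) (B : Form1 d ℝ) : lamSym ρs L k B = zetaS (ρs k) L B := rfl

/-- [folklore] **THE (0.4) ONE-STEP DEFECT IS COARSE-EXACT** with potential `ζ_S`: `contourSum L B − avSym k B = dz (lamSym k B)` pointwise (`SymCorrectorForms.contourSum_sub_dz_zetaS`). -/
theorem contourSum_sub_avSym (k : ℕ) (B : Form1 d ℝ) (μ : Fin d) (Y : Site d) :
    contourSum L B μ Y - avSym ρs L k B μ Y = dz (lamSym ρs L k B) μ Y := by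
  have h := congrFun (congrFun (contourSum_sub_dz_zetaS (ρs k) L B) μ) Y
  simp only [Pi.sub_apply] at h
  rw [avSym_apply, lamSym_apply, ← h]
  ring

/-- [our object — bookkeeping] **THE m-FOLD COMPOSITE (0.4) LINEAR AVERAGE** (`compAvOf` at the sym data). -/
def compLinAvgSymAt (m : ℕ) (A : Form1 d ℝ) : Form1 d ℝ := compAvOf (avSym ρs L) m A

/-- [our object — bookkeeping] **THE COARSE POTENTIAL OF THE COMPOSITE (0.4) AVERAGE's DEFECT** (`compDefectOf` at the sym data): `ζˢ₀ = 0`,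
`ζˢ_{m+1} = blockSum L ζˢ_m + ζ_S (ρs m) (compLinAvgSymAt … m A)`. -/
def compDefectSymAt (m : ℕ) (A : Form1 d ℝ) : Form0 d ℝ := compDefectOf (avSym ρs L) (lamSym ρs L) L m A

/-- [folklore] `m = 0`: the identity. -/
@[simp] theorem compLinAvgSymAt_zero (A : Form1 d ℝ) : compLinAvgSymAt ρs L 0 A = A := rfl

/-- [folklore] The successor clause. -/
theorem compLinAvgSymAt_succ (m : ℕ) (A : Form1 d ℝ) : compLinAvgSymAt ρs L (m + 1) A = avSym ρs L m (compLinAvgSymAt ρs L m A) := rfl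

/-- [folklore] The one-level composite is the (0.4) mean itself. -/
theorem compLinAvgSymAt_one (A : Form1 d ℝ) : compLinAvgSymAt ρs L 1 A = avSym ρs L 0 A := rfl

/-- [folklore] `m = 0`: zero potential. -/
@[simp] theorem compDefectSymAt_zero (A : Form1 d ℝ) : compDefectSymAt ρs L 0 A = 0 := rfl

/-- [folklore] The successor clause of the potential. -/
theorem compDefectSymAt_succ (m : ℕ) (A : Form1 d ℝ) :
    compDefectSymAt ρs L (m + 1) A = blockSum L (compDefectSymAt ρs L m A) + zetaS (ρs m) L (compLinAvgSymAt ρs L m A) := rfl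

/-- [folklore] **K-U3b′-SYM — COARSE-EXACTNESS OF THE COMPOSITE (0.4) AVERAGE's DEFECT WITH ITS EXPLICIT POTENTIAL.**  For `0 < L`, every root sequence, every `m`, every field:
`contourSum (L^m) A − compLinAvgSymAt ρs L m A = dz (compDefectSymAt ρs L m A)` (§1 at the sym data, `hdef := contourSum_sub_avSym`). -/
theorem contourSum_pow_sub_compLinAvgSymAt (hL : 0 < L) (A : Form1 d ℝ) (m : ℕ) (μ : Fin d) (Y : Site d) :
    contourSum (L ^ m) A μ Y - compLinAvgSymAt ρs L m A μ Y = dz (compDefectSymAt ρs L m A) μ Y :=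
  contourSum_pow_sub_compAvOf (avSym ρs L) (lamSym ρs L) L hL (contourSum_sub_avSym ρs L) A m μ Y

/-- [folklore] The same as an identity of 1-forms. -/
theorem contourSum_pow_eq_compLinAvgSymAt_add_dz (hL : 0 < L) (A : Form1 d ℝ) (m : ℕ) :
    contourSum (L ^ m) A = compLinAvgSymAt ρs L m A + dz (compDefectSymAt ρs L m A) :=
  contourSum_pow_eq_compAvOf_add_dz (avSym ρs L) (lamSym ρs L) L hL (contourSum_sub_avSym ρs L) A m

/-- [folklore] The composite (0.4) defect is curvature-free on the coarse lattice. -/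
theorem curv_contourSum_pow_sub_compLinAvgSymAt (hL : 0 < L) (A : Form1 d ℝ) (m : ℕ) :
    curv (contourSum (L ^ m) A - compLinAvgSymAt ρs L m A) = 0 :=
  curv_contourSum_pow_sub_compAvOf (avSym ρs L) (lamSym ρs L) L hL (contourSum_sub_avSym ρs L) A m

end Sym

end

end Summit.QuantumFields.BalabanUV.Beta.CompositeAveragingCoarseExactGeneric
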